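/-
Lead `ym-line-sgb-k1` (seat prover-ym-line-sgb-k1-g0-0), route `SteinGapBootstrap`, crux `SteinBlockTransferG`
(stmt-QuantumFields-22998), line `birth`: structural reduction of the crux to a power-rate bound on the clustering rate.
-/
import Summits.QuantumFields.YangMills.Theses.SteinGapBootstrap

/-!
# Crux `SteinBlockTransferG` (route `SteinGapBootstrap`, rev 2): the crux follows from ANY power-rate bound
# `m ≤ β^{-ε}` on the pair-clustering rate of torus-limit states

The crux `Summit.QuantumFields.YangMills.Theses.SteinGapBootstrap.SteinBlockTransferG` (item stmt-QuantumFields-22998)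
bounds, for every torus-limit state `μ` that is (i) equipartitioned, (ii) axis-symmetric and (iii) pair-clustering across
the time hyperplane at rate `m > 0`, the distance of the probe time-covariance at separation `n ≥ 1` from the free-gluon
profile `g_D(n) = 2^{-D}((1 - c_n²)^{-D/2} - 1)` by `C (1 + m⁻¹ + n)^K β^{-δ}`, where the constants `K, δ > 0, C > 0, β₀`
are EXISTENTIALLY FREE (they may depend on `G`, `r`, `C₀`).

Observation recorded here (lead's structural analysis, no Stein content): the left-hand side is bounded by an absolute
constant — the probe `exp(-2(β·cost)₊)` takes values in `(0, 1]`, so its covariance is at most `2` in absolute value, and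
`0 < c_n ≤ 2/3` (tree `EquipartitionPinsProbe.Reduction.corr_pos/corr_le`) bounds the profile term by `(5/9)^{-D/2} + 1` —
while the right-hand side contains the factor `(1 + m⁻¹ + n)^K`.  Hence, with `K = 1` and `δ = ε`, the crux holds for
every state whose clustering rate obeys `m ≤ β^{-ε}`: then `m⁻¹ ≥ β^{ε}` and `C (1 + m⁻¹ + n) β^{-ε} ≥ C`.
Consequently (`SteinBlockTransferG_of_clusterRate`) the crux is implied by a POWER-RATE bound on the hypothesis-(iii)
clustering rate of torus-limit states — an `XiPow`-type statement for the sup-norm pair-clustering rate — with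
hypotheses (i) and (ii) unused.  The companion file `SteinGapBootstrapSteinBlockTransferGFloorRate` derives that rate
bound from the torus-side plaquette floor `PolySeparationPlaquetteFloor` and discharges it for `SU(2)`.

HONEST FRAMING: nothing here is a statement about the Yang–Mills mass gap; the crux belongs to a line on the RECORD-label
rung R2ξ′ (`WeakCouplingRates.XiPow`, an UPPER bound on lattice gaps), and this file only exhibits which part of the
crux's hypotheses its conclusion actually depends on.
-/

set_option autoImplicit false

noncomputable section

open MeasureTheory Filter Topology
open Literature.MathematicalPhysics.QuantumFieldTheory
open Literature.MathematicalPhysics.QuantumLattice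
open Literature.Probability.LatticeModels
open Summit.QuantumFields.YangMills.Theorems.WeakCouplingRates

namespace Summit.QuantumFields.YangMills.Theorems.SteinGapBootstrap

/-- The free-gluon profile term of the crux is bounded uniformly in the separation: for `n ≠ 0` and `D ≥ 0`,
`|2^{-D}((1 - c_n²)^{-D/2} - 1)| ≤ (5/9)^{-D/2} + 1` (from `0 < c_n ≤ 2/3`). -/
theorem abs_profile_le {D : ℝ} (hD : 0 ≤ D) {n : ℤ} (hn : n ≠ 0) :
    |(2 : ℝ) ^ (-D) * ((1 - curvaturePlaquetteCorr (d := 4) (by norm_num) n ^ 2) ^ (-(D / 2)) - 1)| ≤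
      (5 / 9 : ℝ) ^ (-(D / 2)) + 1 := by
  have hc0 : 0 < curvaturePlaquetteCorr (d := 4) (by norm_num) n :=
    EquipartitionPinsProbe.Reduction.corr_pos hn
  have hc1 : curvaturePlaquetteCorr (d := 4) (by norm_num) n ≤ 2 / 3 :=
    EquipartitionPinsProbe.Reduction.corr_le hn
  set c : ℝ := curvaturePlaquetteCorr (d := 4) (by norm_num) n with hcdef
  have hbase : (5 / 9 : ℝ) ≤ 1 - c ^ 2 := by nlinarith
  have hexp : -(D / 2) ≤ 0 := by linarith
  have hx0 : 0 ≤ (1 - c ^ 2) ^ (-(D / 2)) := Real.rpow_nonneg (by linarith) _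
  have hx1 : (1 - c ^ 2) ^ (-(D / 2)) ≤ (5 / 9 : ℝ) ^ (-(D / 2)) :=
    Real.rpow_le_rpow_of_nonpos (by norm_num) hbase hexp
  have h20 : 0 ≤ (2 : ℝ) ^ (-D) := Real.rpow_nonneg (by norm_num) _
  have h21 : (2 : ℝ) ^ (-D) ≤ 1 := Real.rpow_le_one_of_one_le_of_nonpos (by norm_num) (by linarith)
  rw [abs_mul, abs_of_nonneg h20]
  have habs : |(1 - c ^ 2) ^ (-(D / 2)) - 1| ≤ (5 / 9 : ℝ) ^ (-(D / 2)) + 1 := by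
    rw [abs_le]
    constructor <;> linarith
  calc (2 : ℝ) ^ (-D) * |(1 - c ^ 2) ^ (-(D / 2)) - 1|
      ≤ 1 * |(1 - c ^ 2) ^ (-(D / 2)) - 1| :=
        mul_le_mul_of_nonneg_right h21 (abs_nonneg _)
    _ ≤ (5 / 9 : ℝ) ^ (-(D / 2)) + 1 := by rw [one_mul]; exact habs

/-- **The transfer bound from a clustering-rate bound (one group, one representation).**  If every torus-limit state of the
model `r.ρ` at `β ≥ β₁` that is pair-clustering across the time hyperplane at rate `m > 0` (hypothesis (iii) of the crux) has
`m ≤ β^{-ε}`, then the conclusion of `SteinBlockTransferG` holds for `(G, r)` and every `C₀`, with `K = 1`, `δ = ε`,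
`C = (5/9)^{-D/2} + 3`, `β₀ = max β₁ 1`: the factor `(1 + m⁻¹ + n)` is at least `β^{ε}` and the left-hand side is at most
`(5/9)^{-D/2} + 3`.  Hypotheses (i) (equipartition) and (ii) (axis symmetry) are not used. -/
theorem transfer_of_clusterRate
    {G : Type} [Group G] [TopologicalSpace G] [IsTopologicalGroup G] [CompactSpace G] [MeasurableSpace G] [BorelSpace G]
    (r : LatticeRep G) {ε β₁ : ℝ} (hε : 0 < ε)
    (hrate : ∀ β : ℝ, β₁ ≤ β → ∀ μ ∈ infiniteVolumeLimitPoints (d := 4) r.ρ β, ∀ m : ℝ, 0 < m →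
      (∀ (A B : LGConfig 4 G → ℝ), IsPosTimeObs A → IsPosTimeObs B → ∀ a b : ℝ, (∀ U, |A U| ≤ a) → (∀ U, |B U| ≤ b) →
        ∀ t : ℕ, |(∫ U, A (timeReflectLG U) * B (timeShiftLG (G := G) t U) ∂μ) -
          (∫ U, A (timeReflectLG U) ∂μ) * (∫ U, B (timeShiftLG (G := G) t U) ∂μ)| ≤ 2 * Real.exp (-(m * t)) * a * b) →
      m ≤ β ^ (-ε))
    (C₀ : ℝ) :
    ∃ (K δ C β₀ : ℝ), 0 < δ ∧ 0 < C ∧ ∀ β : ℝ, β₀ ≤ β → ∀ μ ∈ infiniteVolumeLimitPoints (d := 4) r.ρ β,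
      (∀ (x : Site 4) (i j : Fin 4), i ≠ j → ∫ U, ((r.N : ℝ) - plaquetteObs r.ρ x i j U) ∂μ ≤ C₀ / β) →
      (∀ (σ : Equiv.Perm (Fin 4)) (F : LGConfig 4 G → ℝ) (S : Finset (Literature.MathematicalPhysics.QuantumLattice.ZdEdge 4)), IsCylinder F S → Continuous F →
        (∃ C, ∀ U, |F U| ≤ C) → ∫ U, F (relabelConfig (edgePerm σ) U) ∂μ = ∫ U, F U ∂μ) →
      ∀ m : ℝ, 0 < m →
      (∀ (A B : LGConfig 4 G → ℝ), IsPosTimeObs A → IsPosTimeObs B → ∀ a b : ℝ, (∀ U, |A U| ≤ a) → (∀ U, |B U| ≤ b) →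
        ∀ t : ℕ, |(∫ U, A (timeReflectLG U) * B (timeShiftLG (G := G) t U) ∂μ) -
          (∫ U, A (timeReflectLG U) ∂μ) * (∫ U, B (timeShiftLG (G := G) t U) ∂μ)| ≤ 2 * Real.exp (-(m * t)) * a * b) →
      ∀ n : ℕ, 1 ≤ n →
      let P : LGConfig 4 G → ℝ := fun U => Real.exp (-2 * max (β * ((r.N : ℝ) - plaquetteObs r.ρ 0 1 2 U)) 0)
      let D : ℝ := (Module.finrank ℝ ↥(Submodule.span ℝ
        {X : Matrix (Fin r.N) (Fin r.N) ℂ | ∀ t : ℝ, NormedSpace.exp ((t : ℂ) • X) ∈ Set.range r.ρ}) : ℝ)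
      let c₂ : ℝ := curvaturePlaquetteCorr (d := 4) (by norm_num) (n : ℤ)
      |((∫ U, P U * P (timeShiftLG (G := G) n U) ∂μ) - (∫ U, P U ∂μ) * (∫ U, P (timeShiftLG (G := G) n U) ∂μ)) -
          (2 : ℝ) ^ (-D) * ((1 - c₂ ^ 2) ^ (-(D / 2)) - 1)| ≤ C * (1 + m⁻¹ + n) ^ K * β ^ (-δ) := by
  set Dn : ℕ := Module.finrank ℝ ↥(Submodule.span ℝ
    {X : Matrix (Fin r.N) (Fin r.N) ℂ | ∀ t : ℝ, NormedSpace.exp ((t : ℂ) • X) ∈ Set.range r.ρ}) with hDn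
  have hC0 : 0 < (5 / 9 : ℝ) ^ (-((Dn : ℝ) / 2)) + 3 := by positivity
  refine ⟨1, ε, (5 / 9 : ℝ) ^ (-((Dn : ℝ) / 2)) + 3, max β₁ 1, hε, hC0, ?_⟩
  intro β hβ μ hμ _hi _hii m hm hiii n hn P D c₂
  have hβ1 : (1 : ℝ) ≤ β := (le_max_right _ _).trans hβ
  have hβ0 : 0 < β := one_pos.trans_le hβ1
  have hmle : m ≤ β ^ (-ε) := hrate β ((le_max_left _ _).trans hβ) μ hμ m hm hiii
  -- the right-hand side is at least `C`
  have hinv : β ^ ε ≤ m⁻¹ := by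
    rw [Real.rpow_neg hβ0.le] at hmle
    exact (le_inv_comm₀ hm (Real.rpow_pos_of_pos hβ0 ε)).1 hmle
  set C : ℝ := (5 / 9 : ℝ) ^ (-((Dn : ℝ) / 2)) + 3 with hCdef
  have hRHS : C ≤ C * (1 + m⁻¹ + (n : ℝ)) ^ (1 : ℝ) * β ^ (-ε) := by
    rw [Real.rpow_one]
    have h1 : β ^ ε * β ^ (-ε) = 1 := by
      rw [Real.rpow_neg hβ0.le, mul_inv_cancel₀ (Real.rpow_pos_of_pos hβ0 ε).ne']
    have h2 : β ^ ε ≤ 1 + m⁻¹ + (n : ℝ) := by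
      have : (0 : ℝ) ≤ n := Nat.cast_nonneg n
      have : (0 : ℝ) ≤ m⁻¹ := inv_nonneg.2 hm.le
      linarith
    have hβε : 0 ≤ β ^ (-ε) := Real.rpow_nonneg hβ0.le _
    calc C = C * (β ^ ε * β ^ (-ε)) := by rw [h1, mul_one]
      _ = C * β ^ ε * β ^ (-ε) := by ring
      _ ≤ C * (1 + m⁻¹ + (n : ℝ)) * β ^ (-ε) :=
        mul_le_mul_of_nonneg_right (mul_le_mul_of_nonneg_left h2 hC0.le) hβε
  -- the left-hand side is at most `C`
  haveI : IsProbabilityMeasure μ := by obtain ⟨_, _, hprob, _⟩ := hμ; exact hprob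
  have hP1 : ∀ U, |P U| ≤ 1 := fun U => by
    have hpos : 0 < P U := Real.exp_pos _
    rw [abs_of_pos hpos]
    refine Real.exp_le_one_iff.2 ?_
    have : 0 ≤ max (β * ((r.N : ℝ) - plaquetteObs r.ρ 0 1 2 U)) 0 := le_max_right _ _
    linarith
  have hint : ∀ f : LGConfig 4 G → ℝ, (∀ U, |f U| ≤ 1) → |∫ U, f U ∂μ| ≤ 1 := fun f hf => by
    have hb : ∀ᵐ U ∂μ, ‖f U‖ ≤ 1 := ae_of_all _ fun U => by rw [Real.norm_eq_abs]; exact hf U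
    have := norm_integral_le_of_norm_le_const hb
    rwa [probReal_univ, mul_one, Real.norm_eq_abs] at this
  have hI1 : |∫ U, P U * P (timeShiftLG (G := G) n U) ∂μ| ≤ 1 :=
    hint _ fun U => by
      rw [abs_mul]
      exact mul_le_one₀ (hP1 _) (abs_nonneg _) (hP1 _)
  have hI2 : |∫ U, P U ∂μ| ≤ 1 := hint _ hP1
  have hI3 : |∫ U, P (timeShiftLG (G := G) n U) ∂μ| ≤ 1 := hint _ fun U => hP1 _
  have hcov : |(∫ U, P U * P (timeShiftLG (G := G) n U) ∂μ) -
      (∫ U, P U ∂μ) * (∫ U, P (timeShiftLG (G := G) n U) ∂μ)| ≤ 2 := by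
    have hprod : |(∫ U, P U ∂μ) * (∫ U, P (timeShiftLG (G := G) n U) ∂μ)| ≤ 1 := by
      rw [abs_mul]
      exact mul_le_one₀ hI2 (abs_nonneg _) hI3
    calc _ ≤ |∫ U, P U * P (timeShiftLG (G := G) n U) ∂μ| +
          |(∫ U, P U ∂μ) * (∫ U, P (timeShiftLG (G := G) n U) ∂μ)| := abs_sub _ _
      _ ≤ 2 := by linarith
  have hn0 : (n : ℤ) ≠ 0 := by exact_mod_cast (Nat.one_le_iff_ne_zero.1 hn)
  have hD : D = (Dn : ℝ) := rfl
  have hprof : |(2 : ℝ) ^ (-D) * ((1 - c₂ ^ 2) ^ (-(D / 2)) - 1)| ≤ (5 / 9 : ℝ) ^ (-(D / 2)) + 1 :=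
    abs_profile_le (by rw [hD]; exact Nat.cast_nonneg _) hn0
  have hLHS : |((∫ U, P U * P (timeShiftLG (G := G) n U) ∂μ) - (∫ U, P U ∂μ) * (∫ U, P (timeShiftLG (G := G) n U) ∂μ)) -
      (2 : ℝ) ^ (-D) * ((1 - c₂ ^ 2) ^ (-(D / 2)) - 1)| ≤ C := by
    rw [hCdef, ← hD]
    calc _ ≤ |(∫ U, P U * P (timeShiftLG (G := G) n U) ∂μ) - (∫ U, P U ∂μ) * (∫ U, P (timeShiftLG (G := G) n U) ∂μ)| +
          |(2 : ℝ) ^ (-D) * ((1 - c₂ ^ 2) ^ (-(D / 2)) - 1)| := abs_sub _ _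
      _ ≤ 2 + ((5 / 9 : ℝ) ^ (-(D / 2)) + 1) := add_le_add hcov hprof
      _ = (5 / 9 : ℝ) ^ (-(D / 2)) + 3 := by ring
  exact hLHS.trans hRHS

/-- **The crux from a clustering-rate bound.**  If for every compact simple `G` and faithful unitary lattice representation `r`
there are `ε > 0` and `β₁` such that every torus-limit state at `β ≥ β₁` that is pair-clustering across the time hyperplane at
rate `m > 0` (hypothesis (iii) of the crux, verbatim) has `m ≤ β^{-ε}`, then `SteinBlockTransferG` holds — with no generator
comparison, by `transfer_of_clusterRate`.  This isolates what the crux AS FILED depends on: a power-rate upper bound on the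
sup-norm pair-clustering rate of torus-limit states (the `XiPow` pattern for hypothesis (iii)). -/
theorem SteinBlockTransferG_of_clusterRate
    (H : ∀ (G : Type) [Group G] [TopologicalSpace G] [IsTopologicalGroup G] [CompactSpace G],
      IsCompactSimpleLieGroup G →
      letI : MeasurableSpace G := borel G
      haveI : BorelSpace G := ⟨rfl⟩
      ∀ r : LatticeRep G, ∃ ε β₁ : ℝ, 0 < ε ∧ ∀ β : ℝ, β₁ ≤ β →
        ∀ μ ∈ infiniteVolumeLimitPoints (d := 4) r.ρ β, ∀ m : ℝ, 0 < m →
        (∀ (A B : LGConfig 4 G → ℝ), IsPosTimeObs A → IsPosTimeObs B → ∀ a b : ℝ, (∀ U, |A U| ≤ a) →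
          (∀ U, |B U| ≤ b) → ∀ t : ℕ, |(∫ U, A (timeReflectLG U) * B (timeShiftLG (G := G) t U) ∂μ) -
            (∫ U, A (timeReflectLG U) ∂μ) * (∫ U, B (timeShiftLG (G := G) t U) ∂μ)| ≤
              2 * Real.exp (-(m * t)) * a * b) →
        m ≤ β ^ (-ε)) :
    Summit.QuantumFields.YangMills.Theses.SteinGapBootstrap.SteinBlockTransferG := by
  intro G _ _ _ _ hG
  letI : MeasurableSpace G := borel G
  haveI : BorelSpace G := ⟨rfl⟩
  intro r C₀
  obtain ⟨ε, β₁, hε, hrate⟩ := H G hG r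
  exact transfer_of_clusterRate (G := G) r hε hrate C₀

end Summit.QuantumFields.YangMills.Theorems.SteinGapBootstrap

end
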